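import Summits.KontsevichZagierPeriods.KontsevichZagierPeriods.Theses.VietaFibre
import Summits.KontsevichZagierPeriods.KontsevichZagierPeriods.Theses.OctahedralSymmetry
import Summits.KontsevichZagierPeriods.KontsevichZagierPeriods.Theses.CoactionDevissage
import Summits.KontsevichZagierPeriods.KontsevichZagierPeriods.Theses.AyoubSpecialisation
import Summits.KontsevichZagierPeriods.KontsevichZagierPeriods.Theses.SelbergAMGM
import Summits.KontsevichZagierPeriods.KontsevichZagierPeriods.Theses.Neg
import Summits.KontsevichZagierPeriods.KontsevichZagierPeriods.Theorems.VietaFibreKernelFormCut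
import Summits.KontsevichZagierPeriods.KontsevichZagierPeriods.Theorems.VietaFibreKernelFormWeakKernelDictionary
import Summits.KontsevichZagierPeriods.KontsevichZagierPeriods.Theorems.TerasomaMultiplicationBetaCancellationOfAyoubPiCancellation
import Summits.KontsevichZagierPeriods.KontsevichZagierPeriods.Theorems.MzvKernelInKZ.Negative.ScalingDivision
import HarnessLib

/-!
# Crux `KernelForm` (stmt-KontsevichZagierPeriods-10447), line `Sketch`: the item dictionary —
# the crux is, BY NAME, item 3165, and the conjunction of items 0541 and 5621 (or 0541 and 0540)

Leads c0–c2 of the line `Sketch` cut the crux `KernelForm` (kernel form of Kontsevich–Zagier's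
Conjecture 1 for the calculus of `KZCalculus.lean`) as `KernelForm ↔ WeakKernel ∧ Cancellation` and
identified the geometric half with ledger items (`Cancellation ↔ SelbergAMGM.PositiveCancellation`,
stmt-5621; `↔ ¬ Neg.CancellationGap`, stmt-11011), but the transcendence half `WeakKernel` is not a
ledger item. This file closes the dictionary on EXISTING items only, so that the crux can be recorded
as decided by other routes' cruxes without reading any proof:

* `kernelForm_iff_rationalKernel` — `KernelForm ↔ CoactionDevissage.RationalKernel` (stmt-3165, the
  conjecture with `ℚ`-coefficients): integer division is a derived rule of the calculus
  (`MzvKernelInKZ.Negative.mem_relations_of_nsmul_mem`), so the two shared cruxes are ONE statement;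
* `ayoubPiLocalKernel_iff_piLocalKernel` — item stmt-0541 in its filed (pinned-product) typing is the
  closed-term `KZ.PiLocalKernel` of `KZProduct.lean` (the pinned family `P n r = [π] ⋆ r` exists and
  `lift (of ∘ P)` is `[π] * ·` modulo one rule-(2) move, `BetaCancellationLine.exists_pinned` /
  `piRep_mul_sub_lift_mem_relations`; iterated here);
* `ayoubPiLocalKernel_of_kernelForm` (`N = 0`) and `ayoubPiCancellation_of_positiveCancellation`
  (stmt-5621 ⇒ stmt-0540: a canceller of value `π ≠ 0`);
* `kernelForm_iff_ayoubPiLocalKernel_and_positiveCancellation` —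
  **`KernelForm ↔ AyoubPiLocalKernel (0541) ∧ PositiveCancellation (5621)`**;
* `kernelForm_iff_ayoubPiLocalKernel_and_ayoubPiCancellation` —
  `KernelForm ↔ AyoubPiLocalKernel (0541) ∧ AyoubPiCancellation (0540)` (route AyoubSpecialisation's
  split, for the pinned items as filed);
* `kernelForm_iff_ayoubPiLocalKernel_and_not_cancellationGap` — the same with route Neg's crux
  (stmt-11011) negated;
* the twins for route OctahedralSymmetry's (definitionally equal) name of the crux.

Nothing here is conjecture-grade and no statement of any item is altered: every item enters by its
route-file name. Sources: M. Kontsevich, D. Zagier, *Periods* (2001), §1.2 Conjecture 1, §4.1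
(`P̂ = P[(2πi)⁻¹]`); J. Ayoub, *Periods and the conjectures of Grothendieck and Kontsevich–Zagier*,
EMS Newsl. 91 (2014), Def. 6, Conj. 7; A. Huber, G. Wüstholz, *Transcendence and linear relations of
1-periods* (2022), App. A.3–A.4 (the motivic shadow of cancellation is open in print).
-/

noncomputable section

open Literature.NumberTheory.Transcendental
open Summit.KontsevichZagierPeriods.KontsevichZagierPeriods.Theses

namespace Summit.KontsevichZagierPeriods.KernelForm.LocaliseAtValuePrime

/-! ### `KernelForm` is item 3165 (`RationalKernel`) -/

/-- **`KernelForm ↔ RationalKernel`** (stmt-10447 ↔ stmt-3165). `→`: `n = 1`. `←`: if `n • c` is a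
relation with `n ≠ 0` then so is `c` — integer division is a derived rule of the calculus (rational
scaling is a change of variables plus additivity; `MzvKernelInKZ.Negative.mem_relations_of_nsmul_mem`).
[folklore] -/
theorem kernelForm_iff_rationalKernel :
    Summit.KontsevichZagierPeriods.KontsevichZagierPeriods.Theses.VietaFibre.KernelForm ↔
      Summit.KontsevichZagierPeriods.KontsevichZagierPeriods.Theses.CoactionDevissage.RationalKernel := by
  unfold Summit.KontsevichZagierPeriods.KontsevichZagierPeriods.Theses.VietaFibre.KernelForm
    Summit.KontsevichZagierPeriods.KontsevichZagierPeriods.Theses.CoactionDevissage.RationalKernel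
  constructor
  · intro hK c hc
    exact ⟨1, one_ne_zero, by simpa using hK c hc⟩
  · intro hR c hc
    obtain ⟨n, hn, hnc⟩ := hR c hc
    exact Summit.KontsevichZagierPeriods.MzvKernelInKZ.Negative.mem_relations_of_nsmul_mem
      (Nat.pos_of_ne_zero hn) hnc

/-! ### Item 0541 as filed is `KZ.PiLocalKernel` -/

/-- For a pinned family `P` (`P n r = [π] ⋆ r` with the disc in the two leading coordinates), the
left-nested iterates of `[π] * ·` and of `lift (of ∘ P)` agree modulo relations:
`([π] * ·)^[N] c − (lift (of ∘ P))^[N] c ∈ relations` (induction on `N`; one step is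
`BetaCancellationLine.piRep_mul_sub_lift_mem_relations`, and `relations` is a left ideal).
[folklore] -/
theorem iterate_piRep_mul_sub_iterate_lift_mem_relations
    (P : ∀ n : ℕ, KZ.IntegralRep n → KZ.IntegralRep (n + 2))
    (hP : ∀ (n : ℕ) (r : KZ.IntegralRep n),
      (P n r).domain = {z : Fin (n + 2) → ℝ | z 0 ^ 2 + z 1 ^ 2 ≤ 1 ∧
          (fun i : Fin n => z i.succ.succ) ∈ r.domain} ∧
        (P n r).integrand = fun z => r.integrand (fun i : Fin n => z i.succ.succ))
    (N : ℕ) (c : KZ.FormalRep) :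
    (fun x => KZ.of KZ.piRep * x)^[N] c -
        (⇑(FreeAbelianGroup.lift (fun s : (Σ n, KZ.IntegralRep n) => KZ.of (P s.1 s.2))))^[N] c ∈
      KZ.relations := by
  induction N with
  | zero => simp [KZ.relations.zero_mem]
  | succ N ih =>
    rw [Function.iterate_succ_apply', Function.iterate_succ_apply']
    set a := (fun x => KZ.of KZ.piRep * x)^[N] c with ha
    set b := (⇑(FreeAbelianGroup.lift (fun s : (Σ n, KZ.IntegralRep n) => KZ.of (P s.1 s.2))))^[N] c
      with hb
    have h1 : KZ.of KZ.piRep * a - KZ.of KZ.piRep * b ∈ KZ.relations := by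
      rw [← mul_sub]
      exact KZ.mul_mem_relations_left_holds _ _ ih
    have h2 := Summit.KontsevichZagierPeriods.KontsevichZagierPeriods.BetaCancellationLine.piRep_mul_sub_lift_mem_relations
      P hP b
    have e : KZ.of KZ.piRep * a -
        FreeAbelianGroup.lift (fun s : (Σ n, KZ.IntegralRep n) => KZ.of (P s.1 s.2)) b =
        (KZ.of KZ.piRep * a - KZ.of KZ.piRep * b) +
          (KZ.of KZ.piRep * b -
            FreeAbelianGroup.lift (fun s : (Σ n, KZ.IntegralRep n) => KZ.of (P s.1 s.2)) b) := by
      abel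
    rw [e]
    exact KZ.relations.add_mem h1 h2

/-- **`AyoubPiLocalKernel ↔ KZ.PiLocalKernel`**: item stmt-0541 of route AyoubSpecialisation, filed
in interface typing (for every pinned family `P`, every `c` of value `0` has
`(lift (of ∘ P))^[N] c ∈ relations` for some `N`), is the closed-term `π`-local kernel property of
`KZProduct.lean` (`([π] * ·)^[N] c ∈ relations`): the pinned family exists
(`BetaCancellationLine.exists_pinned`) and the two iterates agree modulo relations. [folklore] -/
theorem ayoubPiLocalKernel_iff_piLocalKernel :
    Summit.KontsevichZagierPeriods.KontsevichZagierPeriods.Theses.AyoubSpecialisation.AyoubPiLocalKernel ↔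
      KZ.PiLocalKernel := by
  unfold Summit.KontsevichZagierPeriods.KontsevichZagierPeriods.Theses.AyoubSpecialisation.AyoubPiLocalKernel
    KZ.PiLocalKernel
  constructor
  · intro h c hc
    obtain ⟨P, hP⟩ := Summit.KontsevichZagierPeriods.KontsevichZagierPeriods.BetaCancellationLine.exists_pinned
    obtain ⟨N, hN⟩ := h P hP c hc
    refine ⟨N, ?_⟩
    have h' := KZ.relations.add_mem (iterate_piRep_mul_sub_iterate_lift_mem_relations P hP N c) hN
    simpa using h'
  · intro h P hP c hc
    obtain ⟨N, hN⟩ := h c hc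
    refine ⟨N, ?_⟩
    have h' := KZ.relations.sub_mem hN (iterate_piRep_mul_sub_iterate_lift_mem_relations P hP N c)
    simpa using h'

/-- **`KernelForm → AyoubPiLocalKernel`** (stmt-10447 ⇒ stmt-0541): exponent `N = 0`. [folklore] -/
theorem ayoubPiLocalKernel_of_kernelForm
    (hK : Summit.KontsevichZagierPeriods.KontsevichZagierPeriods.Theses.VietaFibre.KernelForm) :
    Summit.KontsevichZagierPeriods.KontsevichZagierPeriods.Theses.AyoubSpecialisation.AyoubPiLocalKernel := by
  intro P _ c hc
  exact ⟨0, by simpa using hK c hc⟩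

/-! ### Item 5621 implies item 0540 -/

/-- **`PositiveCancellation → AyoubPiCancellation`** (stmt-5621 ⇒ stmt-0540): positive cancellation is
`Cancellation` (`cancellation_iff_positiveCancellation`), which cancels the canceller `[π]` of value
`π ≠ 0` (`piCancellation_of_cancellation`), and item 0540 as filed is `KZ.PiCancellation`
(`BetaCancellationLine.stub_ayoubBridge`). [folklore] -/
theorem ayoubPiCancellation_of_positiveCancellation
    (h : Summit.KontsevichZagierPeriods.KontsevichZagierPeriods.Theses.SelbergAMGM.PositiveCancellation) :
    Summit.KontsevichZagierPeriods.KontsevichZagierPeriods.Theses.AyoubSpecialisation.AyoubPiCancellation :=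
  Summit.KontsevichZagierPeriods.KontsevichZagierPeriods.BetaCancellationLine.stub_ayoubBridge.mpr
    (piCancellation_of_cancellation (cancellation_iff_positiveCancellation.mpr h))

/-! ### The crux decided by items: `KernelForm ↔ 0541 ∧ 5621 ↔ 0541 ∧ 0540 ↔ 0541 ∧ ¬ 11011` -/

/-- **`KernelForm ↔ AyoubPiLocalKernel ∧ PositiveCancellation`** (stmt-10447 ↔ stmt-0541 ∧ stmt-5621).
`→`: `N = 0`, and the crux gives `Cancellation`, i.e. positive cancellation. `←`: item 0541 is
`KZ.PiLocalKernel`, which gives the weak kernel (`weakKernel_of_piLocalKernel`: the killer `[π]^N` has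
value `π^N ≠ 0`), item 5621 is `Cancellation`, and the cut `kernelForm_iff` composes them. [folklore] -/
theorem kernelForm_iff_ayoubPiLocalKernel_and_positiveCancellation :
    Summit.KontsevichZagierPeriods.KontsevichZagierPeriods.Theses.VietaFibre.KernelForm ↔
      Summit.KontsevichZagierPeriods.KontsevichZagierPeriods.Theses.AyoubSpecialisation.AyoubPiLocalKernel ∧
        Summit.KontsevichZagierPeriods.KontsevichZagierPeriods.Theses.SelbergAMGM.PositiveCancellation := by
  constructor
  · intro hK
    exact ⟨ayoubPiLocalKernel_of_kernelForm hK,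
      cancellation_iff_positiveCancellation.mp (kernelForm_iff.mp hK).2⟩
  · rintro ⟨hL, hP⟩
    exact kernelForm_iff.mpr
      ⟨weakKernel_of_piLocalKernel (ayoubPiLocalKernel_iff_piLocalKernel.mp hL),
        cancellation_iff_positiveCancellation.mpr hP⟩

/-- **`KernelForm ↔ AyoubPiLocalKernel ∧ AyoubPiCancellation`** (stmt-10447 ↔ stmt-0541 ∧ stmt-0540),
route AyoubSpecialisation's split of Conjecture 1 along `[π]`, for the pinned items as filed. `→`:
through positive cancellation. `←`: item 0541 is `KZ.PiLocalKernel` (`[π]^N * c ∈ relations`), item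
0540 is `KZ.PiCancellation`, which peels the `N` factors one at a time. [folklore] -/
theorem kernelForm_iff_ayoubPiLocalKernel_and_ayoubPiCancellation :
    Summit.KontsevichZagierPeriods.KontsevichZagierPeriods.Theses.VietaFibre.KernelForm ↔
      Summit.KontsevichZagierPeriods.KontsevichZagierPeriods.Theses.AyoubSpecialisation.AyoubPiLocalKernel ∧
        Summit.KontsevichZagierPeriods.KontsevichZagierPeriods.Theses.AyoubSpecialisation.AyoubPiCancellation := by
  constructor
  · intro hK
    obtain ⟨hL, hP⟩ := kernelForm_iff_ayoubPiLocalKernel_and_positiveCancellation.mp hK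
    exact ⟨hL, ayoubPiCancellation_of_positiveCancellation hP⟩
  · rintro ⟨hL, hC⟩
    have hL' : KZ.PiLocalKernel := ayoubPiLocalKernel_iff_piLocalKernel.mp hL
    have hC' : KZ.PiCancellation :=
      Summit.KontsevichZagierPeriods.KontsevichZagierPeriods.BetaCancellationLine.stub_ayoubBridge.mp hC
    intro c hc
    obtain ⟨N, hN⟩ := hL' c hc
    induction N with
    | zero => simpa using hN
    | succ N ih => exact ih (hC' _ (by simpa only [Function.iterate_succ_apply'] using hN))

/-- **`KernelForm ↔ AyoubPiLocalKernel ∧ ¬ CancellationGap`** (stmt-10447 ↔ stmt-0541 ∧ ¬ stmt-11011):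
route Neg's crux is exactly `¬ Cancellation` (`cancellationGap_iff_not_cancellation`). [folklore] -/
theorem kernelForm_iff_ayoubPiLocalKernel_and_not_cancellationGap :
    Summit.KontsevichZagierPeriods.KontsevichZagierPeriods.Theses.VietaFibre.KernelForm ↔
      Summit.KontsevichZagierPeriods.KontsevichZagierPeriods.Theses.AyoubSpecialisation.AyoubPiLocalKernel ∧
        ¬ Summit.KontsevichZagierPeriods.KontsevichZagierPeriods.Theses.Neg.CancellationGap := by
  rw [kernelForm_iff_ayoubPiLocalKernel_and_positiveCancellation, cancellationGap_iff_not_cancellation,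
    not_not, cancellation_iff_positiveCancellation]

/-! ### The twins for route OctahedralSymmetry's name of the crux -/

/-- `OctahedralSymmetry.KernelForm ↔ RationalKernel` (stmt-10447 ↔ stmt-3165, OctahedralSymmetry's
name of the shared crux; same term as VietaFibre's). [folklore] -/
theorem octahedralSymmetry_kernelForm_iff_rationalKernel :
    Summit.KontsevichZagierPeriods.KontsevichZagierPeriods.Theses.OctahedralSymmetry.KernelForm ↔
      Summit.KontsevichZagierPeriods.KontsevichZagierPeriods.Theses.CoactionDevissage.RationalKernel :=
  kernelForm_iff_rationalKernel

/-- `OctahedralSymmetry.KernelForm ↔ AyoubPiLocalKernel ∧ PositiveCancellation`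
(stmt-10447 ↔ stmt-0541 ∧ stmt-5621, OctahedralSymmetry's name of the shared crux). [folklore] -/
theorem octahedralSymmetry_kernelForm_iff_ayoubPiLocalKernel_and_positiveCancellation :
    Summit.KontsevichZagierPeriods.KontsevichZagierPeriods.Theses.OctahedralSymmetry.KernelForm ↔
      Summit.KontsevichZagierPeriods.KontsevichZagierPeriods.Theses.AyoubSpecialisation.AyoubPiLocalKernel ∧
        Summit.KontsevichZagierPeriods.KontsevichZagierPeriods.Theses.SelbergAMGM.PositiveCancellation :=
  kernelForm_iff_ayoubPiLocalKernel_and_positiveCancellation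

/-- `OctahedralSymmetry.KernelForm ↔ AyoubPiLocalKernel ∧ AyoubPiCancellation`
(stmt-10447 ↔ stmt-0541 ∧ stmt-0540, OctahedralSymmetry's name of the shared crux). [folklore] -/
theorem octahedralSymmetry_kernelForm_iff_ayoubPiLocalKernel_and_ayoubPiCancellation :
    Summit.KontsevichZagierPeriods.KontsevichZagierPeriods.Theses.OctahedralSymmetry.KernelForm ↔
      Summit.KontsevichZagierPeriods.KontsevichZagierPeriods.Theses.AyoubSpecialisation.AyoubPiLocalKernel ∧
        Summit.KontsevichZagierPeriods.KontsevichZagierPeriods.Theses.AyoubSpecialisation.AyoubPiCancellation :=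
  kernelForm_iff_ayoubPiLocalKernel_and_ayoubPiCancellation

end Summit.KontsevichZagierPeriods.KernelForm.LocaliseAtValuePrime
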